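import Summits.CriticalPhenomena.PercolationContinuityZ3.Theorems.PercNearOneGluingNoHeavyLowerTailSahiCombTriWRungTwo

/-!
# The pq-COMPRESSION IDENTITY for the incomparable pair at `a = 2`, and the TILT reduction of `TRI_W(2) ≥ 0`

Support file of the one-cut programme (crux `NoHeavyLowerTail`, stmt-CriticalPhenomena-4575; cell `prim-masterthm`, seat P5 gen 13;
report `P5-LORENTZIAN-TEST.md` §18.3).

For an index cube of size two, `2·triW = Σ_x triWOne(P; F x, F xᶜ; G x, G xᶜ)` (`two_mul_triW`), i.e. `TRI_W(2)` is the thin-edge functional of the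
OUTER nested pair `(F ∅ ⊆ F univ; G ∅ ⊆ G univ)` plus the thin-edge functional of the INNER, in general NON-nested, pair `(F{a}, F{b}; G{a}, G{b})`
(`…SahiCombTriWSharp`).  The outer term is `≥ 0` by the five-up-set theorem (`triWOne_nonneg_cube`); the inner one is the whole difficulty.
This file COMPRESSES the inner pair: replacing `(A, B)` by the nested pair `(A ∩ B, A ∪ B)` (and `(C, D)` by `(C ∩ D, C ∪ D)`) changes the
thin-edge functional by an explicit signed count of TILT patterns:

* **`LatticeFiveUpSet.triWOne_compression`** (an identity, no hypotheses on the five families):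
  `triWOne c P A B C D = triWOne c P (A ∩ B) (A ∪ B) (C ∩ D) (C ∪ D) + 2·#(P ∩ refl O) − 2·#(P ∩ O) − #(P ∩ X₁) − #(P ∩ X₂)`, where `c` is complementation,
  `O = (A \ B) ∩ (D \ C) ∪ (B \ A) ∩ (C \ D)` (points where the two pairs are TILTED IN OPPOSITE directions),
  `X₁ = (A \ B) ∩ refl (D \ C) ∪ (B \ A) ∩ refl (C \ D)`, `X₂ = refl (A \ B) ∩ (D \ C) ∪ refl (B \ A) ∩ (C \ D)` (a point and its antipode oppositely tilted
  across the two pairs).  Proof: point-by-point over `P`, `decide` on the `2⁸` membership patterns of `w, wᶜ`.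
* **`LatticeFiveUpSet.triWOne_ge_tilt`** — for up-sets `P, A, B, C, D` of a finite cube:
  `2·#(P ∩ refl O) − 2·#(P ∩ O) − #(P ∩ X₁) − #(P ∩ X₂) ≤ triWOne c P A B C D` (the compressed pair is nested, so its functional is `≥ 0` by
  `triWOne_nonneg_cube`).  Hence (report §18.3) `TRI_W(2) ≥ 0` would follow from the TILT inequality
  `2·#(P ∩ O) + #(P ∩ X₁) + #(P ∩ X₂) − 2·#(P ∩ refl O) ≤ triWOne(outer pair) + triWOne(compressed inner pair)`, whose right-hand side is a sum of two
  thin-edge functionals; this inequality is census-true (exhaustive `(2,2)`, `(2,3)`) and OPEN.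
HONEST LABEL: an identity and its immediate corollary; `FiveUpSet.TriWIneq` is NOT advanced beyond this reformulation. [this work]
-/

namespace Summit.CriticalPhenomena.PercolationContinuityZ3.Theorems

open Finset FiveUpSet

namespace LatticeFiveUpSet

variable {γ : Type} [DecidableEq γ] [Fintype γ]

omit [Fintype γ] in
/-- A membership bit as an element of `Fin 2` (for kernel case analysis). [this work] -/
theorem mem_code (A : Finset (Finset γ)) (w : Finset γ) : ∃ s : Fin 2, (w ∈ A ↔ s = 1) := by
  by_cases h : w ∈ A
  · exact ⟨1, by simp [h]⟩
  · exact ⟨0, by simp [h]⟩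

/-- **The pq-compression identity** (report §18.3): compressing the inner pair `(A,B;C,D) ↦ (A∩B, A∪B; C∩D, C∪D)` changes the thin-edge functional
by `2·#(P ∩ refl O) − 2·#(P ∩ O) − #(P ∩ X₁) − #(P ∩ X₂)` (opposite-tilt counts; see the module docstring).  No hypotheses. [this work] -/
theorem triWOne_compression (P A B C D : Finset (Finset γ)) :
    triWOne (complEquiv γ) P A B C D
      = triWOne (complEquiv γ) P (A ∩ B) (A ∪ B) (C ∩ D) (C ∪ D)
        + 2 * ((P ∩ refl ((A \ B) ∩ (D \ C) ∪ (B \ A) ∩ (C \ D))).card : ℤ)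
        - 2 * ((P ∩ ((A \ B) ∩ (D \ C) ∪ (B \ A) ∩ (C \ D))).card : ℤ)
        - ((P ∩ ((A \ B) ∩ refl (D \ C) ∪ (B \ A) ∩ refl (C \ D))).card : ℤ)
        - ((P ∩ (refl (A \ B) ∩ (D \ C) ∪ refl (B \ A) ∩ (C \ D))).card : ℤ) := by
  unfold triWOne
  simp only [image_complEquiv]
  rw [card_inter_inter_eq_sum P (A) (C),
      card_inter_inter_eq_sum P (B) (D),
      card_inter_inter_eq_sum P (refl A) (D),
      card_inter_inter_eq_sum P (refl B) (C),
      card_inter_inter_eq_sum P (A) (refl D),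
      card_inter_inter_eq_sum P (B) (refl C),
      card_inter_inter_eq_sum P (refl A) (refl C),
      card_inter_inter_eq_sum P (refl B) (refl D),
      card_inter_inter_eq_sum P (refl A) (refl D),
      card_inter_inter_eq_sum P (refl B) (refl C),
      card_inter_inter_eq_sum P ((A ∩ B)) ((C ∩ D)),
      card_inter_inter_eq_sum P ((A ∪ B)) ((C ∪ D)),
      card_inter_inter_eq_sum P (refl (A ∩ B)) ((C ∪ D)),
      card_inter_inter_eq_sum P (refl (A ∪ B)) ((C ∩ D)),
      card_inter_inter_eq_sum P ((A ∩ B)) (refl (C ∪ D)),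
      card_inter_inter_eq_sum P ((A ∪ B)) (refl (C ∩ D)),
      card_inter_inter_eq_sum P (refl (A ∩ B)) (refl (C ∩ D)),
      card_inter_inter_eq_sum P (refl (A ∪ B)) (refl (C ∪ D)),
      card_inter_inter_eq_sum P (refl (A ∩ B)) (refl (C ∪ D)),
      card_inter_inter_eq_sum P (refl (A ∪ B)) (refl (C ∩ D))]
  rw [card_inter_eq_sum P (refl ((A \ B) ∩ (D \ C) ∪ (B \ A) ∩ (C \ D))),
      card_inter_eq_sum P (((A \ B) ∩ (D \ C) ∪ (B \ A) ∩ (C \ D))),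
      card_inter_eq_sum P (((A \ B) ∩ refl (D \ C) ∪ (B \ A) ∩ refl (C \ D))),
      card_inter_eq_sum P ((refl (A \ B) ∩ (D \ C) ∪ refl (B \ A) ∩ (C \ D)))]
  simp only [mem_inter, mem_refl, mem_sdiff, mem_union, Finset.mul_sum, ← Finset.sum_add_distrib, ← Finset.sum_sub_distrib]
  refine Finset.sum_congr rfl (fun w _ => ?_)
  obtain ⟨a, ha⟩ := mem_code A w
  obtain ⟨b, hb⟩ := mem_code B w
  obtain ⟨c, hc⟩ := mem_code C w
  obtain ⟨d, hd⟩ := mem_code D w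
  obtain ⟨a', ha'⟩ := mem_code A wᶜ
  obtain ⟨b', hb'⟩ := mem_code B wᶜ
  obtain ⟨c', hc'⟩ := mem_code C wᶜ
  obtain ⟨d', hd'⟩ := mem_code D wᶜ
  simp only [ha, hb, hc, hd, ha', hb', hc', hd']
  clear ha hb hc hd ha' hb' hc' hd'
  revert a b c d a' b' c' d'
  decide

/-- **The TILT lower bound for a non-nested pair**: for up-sets `P, A, B, C, D`,
`2·#(P ∩ refl O) − 2·#(P ∩ O) − #(P ∩ X₁) − #(P ∩ X₂) ≤ triWOne c P A B C D` — the compressed pair `(A∩B ⊆ A∪B; C∩D ⊆ C∪D)` is nested, so its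
thin-edge functional is `≥ 0` (`triWOne_nonneg_cube`, the five-up-set theorem). [this work] -/
theorem triWOne_ge_tilt (P A B C D : Finset (Finset γ)) (hP : IsUpperSet (P : Set (Finset γ)))
    (hA : IsUpperSet (A : Set (Finset γ))) (hB : IsUpperSet (B : Set (Finset γ))) (hC : IsUpperSet (C : Set (Finset γ)))
    (hD : IsUpperSet (D : Set (Finset γ))) :
    2 * ((P ∩ refl ((A \ B) ∩ (D \ C) ∪ (B \ A) ∩ (C \ D))).card : ℤ)
        - 2 * ((P ∩ ((A \ B) ∩ (D \ C) ∪ (B \ A) ∩ (C \ D))).card : ℤ)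
        - ((P ∩ ((A \ B) ∩ refl (D \ C) ∪ (B \ A) ∩ refl (C \ D))).card : ℤ)
        - ((P ∩ (refl (A \ B) ∩ (D \ C) ∪ refl (B \ A) ∩ (C \ D))).card : ℤ)
      ≤ triWOne (complEquiv γ) P A B C D := by
  have hM : IsUpperSet ((A ∩ B : Finset (Finset γ)) : Set (Finset γ)) := by rw [coe_inter]; exact hA.inter hB
  have hJ : IsUpperSet ((A ∪ B : Finset (Finset γ)) : Set (Finset γ)) := by rw [coe_union]; exact hA.union hB
  have hM' : IsUpperSet ((C ∩ D : Finset (Finset γ)) : Set (Finset γ)) := by rw [coe_inter]; exact hC.inter hD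
  have hJ' : IsUpperSet ((C ∪ D : Finset (Finset γ)) : Set (Finset γ)) := by rw [coe_union]; exact hC.union hD
  have h0 := FiveUpSet.triWOne_nonneg_cube γ P (A ∩ B) (A ∪ B) (C ∩ D) (C ∪ D) hP hM hJ hM' hJ'
    (inter_subset_left.trans subset_union_left) (inter_subset_left.trans subset_union_left)
  have h1 := triWOne_compression P A B C D
  have e : (⟨compl, compl, compl_compl, compl_compl⟩ : Finset γ ≃ Finset γ) = complEquiv γ := rfl
  rw [e] at h0
  linarith


/-! ### Untilted families: a new unconditional stratum of `TRI_W(2) ≥ 0` (appended, gen 13) -/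

/-- The antipodal image of the empty family is empty. [this work] -/
theorem refl_empty_family : refl (∅ : Finset (Finset γ)) = ∅ := by
  unfold FiveUpSet.refl
  exact Finset.map_empty _

/-- If the second pair is untilted (`C = D`) the tilt terms vanish: `0 ≤ triWOne c P A B C C` for up-sets `P, A, B, C` (no nesting of `A, B` needed). [this work] -/
theorem triWOne_nonneg_of_right_untilted (P A B C : Finset (Finset γ)) (hP : IsUpperSet (P : Set (Finset γ)))
    (hA : IsUpperSet (A : Set (Finset γ))) (hB : IsUpperSet (B : Set (Finset γ))) (hC : IsUpperSet (C : Set (Finset γ))) :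
    0 ≤ triWOne (complEquiv γ) P A B C C := by
  have h := triWOne_ge_tilt P A B C C hP hA hB hC hC
  simpa [refl_empty_family] using h

/-- If the first pair is untilted (`A = B`): `0 ≤ triWOne c P A A C D` for up-sets `P, A, C, D`. [this work] -/
theorem triWOne_nonneg_of_left_untilted (P A C D : Finset (Finset γ)) (hP : IsUpperSet (P : Set (Finset γ)))
    (hA : IsUpperSet (A : Set (Finset γ))) (hC : IsUpperSet (C : Set (Finset γ))) (hD : IsUpperSet (D : Set (Finset γ))) :
    0 ≤ triWOne (complEquiv γ) P A A C D := by
  have h := triWOne_ge_tilt P A A C D hP hA hA hC hD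
  simpa [refl_empty_family] using h


/-- **Pair reduction at `a = 2`** (the enumeration of `…SahiCombTriWSharp`, made hypothesis-free of `SharpTwoIneq`): for an index cube with two atoms
`a ≠ b`, if the outer and inner thin-edge functionals have a non-negative SUM then `0 ≤ triW P F G`. [this work] -/
theorem triW_nonneg_of_pair_nonneg {β : Type} [DecidableEq β] [Fintype β] {a b : β} (hab : a ≠ b) (hu : (univ : Finset β) = {a, b})
    (P : Finset (Finset γ)) (F G : Finset β → Finset (Finset γ))
    (hpair : 0 ≤ triWOne (complEquiv γ) P (F ∅) (F univ) (G ∅) (G univ) + triWOne (complEquiv γ) P (F {a}) (F {b}) (G {a}) (G {b})) :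
    0 ≤ FiveUpSet.triW P F G := by
  set f : Finset β → ℤ := fun x => triWOne (complEquiv γ) P (F x) (F xᶜ) (G x) (G xᶜ) with hf
  have h2 : 2 * FiveUpSet.triW P F G = ∑ x : Finset β, f x := FiveUpSet.two_mul_triW P F G
  have hpb : ({b} : Finset β).powerset = {∅, {b}} := by
    ext t; rw [mem_powerset, subset_singleton_iff, mem_insert, mem_singleton]
  have hia : insert a (∅ : Finset β) = {a} := by ext x; simp
  have hsum : ∑ x : Finset β, f x = f ∅ + f {b} + (f {a} + f {a, b}) := by
    rw [← Finset.powerset_univ, hu, Finset.sum_powerset_insert (by rwa [mem_singleton]), hpb,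
      Finset.sum_pair (Finset.singleton_ne_empty b).symm, Finset.sum_pair (Finset.singleton_ne_empty b).symm, hia]
  have cab : ({a} : Finset β)ᶜ = {b} := FiveUpSet.compl_singleton_eq_of_univ hab hu
  have cba : ({b} : Finset β)ᶜ = {a} := by
    have hu' : (univ : Finset β) = {b, a} := by rw [hu, pair_comm]
    exact FiveUpSet.compl_singleton_eq_of_univ hab.symm hu'
  have cuniv : ({a, b} : Finset β) = univ := hu.symm
  have hsym : ∀ A₀ A₁ B₀ B₁ : Finset (Finset γ),
      triWOne (complEquiv γ) P A₁ A₀ B₁ B₀ = triWOne (complEquiv γ) P A₀ A₁ B₀ B₁ := by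
    intro A₀ A₁ B₀ B₁; unfold triWOne; ring
  have f0 : f ∅ = triWOne (complEquiv γ) P (F ∅) (F univ) (G ∅) (G univ) := by simp only [hf, compl_empty]
  have f1 : f {a, b} = triWOne (complEquiv γ) P (F ∅) (F univ) (G ∅) (G univ) := by
    simp only [hf, cuniv, compl_univ]; exact hsym _ _ _ _
  have fa : f {a} = triWOne (complEquiv γ) P (F {a}) (F {b}) (G {a}) (G {b}) := by simp only [hf, cab]
  have fb : f {b} = triWOne (complEquiv γ) P (F {a}) (F {b}) (G {a}) (G {b}) := by
    simp only [hf, cba]; exact hsym _ _ _ _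
  have : 0 ≤ 2 * FiveUpSet.triW P F G := by rw [h2, hsum, f0, f1, fa, fb]; linarith
  omega

/-- **UNTILTED STRATUM of `TRI_W(2) ≥ 0` (unconditional):** index cube with two atoms `a ≠ b`, up-set `P`, monotone families `F, G` of up-sets with
`G {a} = G {b}` (the second family depends on the index only through its rank — `F` arbitrary, possibly tilted): `0 ≤ triW P F G`.  Not contained in
`triW_nonneg_of_pairwise_nested` (there `F {a}, F {b}` must be nested too). [this work] -/
theorem triW_nonneg_of_right_untilted {β : Type} [DecidableEq β] [Fintype β] {a b : β} (hab : a ≠ b) (hu : (univ : Finset β) = {a, b})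
    (P : Finset (Finset γ)) (F G : Finset β → Finset (Finset γ))
    (hP : IsUpperSet (P : Set (Finset γ))) (hF : ∀ x, IsUpperSet (F x : Set (Finset γ))) (hG : ∀ x, IsUpperSet (G x : Set (Finset γ)))
    (hFm : Monotone F) (hGm : Monotone G) (hGab : G {a} = G {b}) : 0 ≤ FiveUpSet.triW P F G := by
  refine triW_nonneg_of_pair_nonneg hab hu P F G ?_
  have h0 := FiveUpSet.triWOne_nonneg_cube γ P (F ∅) (F univ) (G ∅) (G univ) hP (hF ∅) (hF univ) (hG ∅) (hG univ)
    (hFm (empty_subset _)) (hGm (empty_subset _))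
  have e : (⟨compl, compl, compl_compl, compl_compl⟩ : Finset γ ≃ Finset γ) = complEquiv γ := rfl
  rw [e] at h0
  have h1 := triWOne_nonneg_of_right_untilted P (F {a}) (F {b}) (G {b}) hP (hF {a}) (hF {b}) (hG {b})
  rw [← hGab] at h1
  nth_rewrite 2 [hGab] at h1
  linarith

/-- The mirror stratum: `F {a} = F {b}` (first family untilted, `G` arbitrary) ⇒ `0 ≤ triW P F G`. [this work] -/
theorem triW_nonneg_of_left_untilted {β : Type} [DecidableEq β] [Fintype β] {a b : β} (hab : a ≠ b) (hu : (univ : Finset β) = {a, b})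
    (P : Finset (Finset γ)) (F G : Finset β → Finset (Finset γ))
    (hP : IsUpperSet (P : Set (Finset γ))) (hF : ∀ x, IsUpperSet (F x : Set (Finset γ))) (hG : ∀ x, IsUpperSet (G x : Set (Finset γ)))
    (hFm : Monotone F) (hGm : Monotone G) (hFab : F {a} = F {b}) : 0 ≤ FiveUpSet.triW P F G := by
  refine triW_nonneg_of_pair_nonneg hab hu P F G ?_
  have h0 := FiveUpSet.triWOne_nonneg_cube γ P (F ∅) (F univ) (G ∅) (G univ) hP (hF ∅) (hF univ) (hG ∅) (hG univ)
    (hFm (empty_subset _)) (hGm (empty_subset _))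
  have e : (⟨compl, compl, compl_compl, compl_compl⟩ : Finset γ ≃ Finset γ) = complEquiv γ := rfl
  rw [e] at h0
  have h1 := triWOne_nonneg_of_left_untilted P (F {b}) (G {a}) (G {b}) hP (hF {b}) (hG {a}) (hG {b})
  rw [← hFab] at h1
  nth_rewrite 2 [hFab] at h1
  linarith

end LatticeFiveUpSet

end Summit.CriticalPhenomena.PercolationContinuityZ3.Theorems
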